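/-
Copyright (c) 2026 the pub-hodgecm-mathlib formalisation cell (harness21).  Prover seat hodgecm-mathlib-LH4-p04 (g2), req620 Track A «(D-RAM) FOUR-FRAME» squad
(heir LEAD F0P3a-plan (g19) (R-17) «NI2 ⊕ MS»; dealer LH4-plan (g10); MS ROAD A brick (O2a) of the MS first seat LH4-p11 (g0), dealt BY SIGNATURE 2026-09-03T23:20:09Z).  2026-09-03.
-/
import Summits.HodgeConjecture.HodgeConjecture.Theorems.F0P3cDyRamDiagonalTorusDefs            -- ★ DEFS LEAF p855572 (LH4-p11): `diagGLUnits`, `IsNormalisedLattice`, `normalisedStableLattices`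
import Summits.HodgeConjecture.HodgeConjecture.Theorems.F0P3cDyRamDiagonalNormalisedOrbit        -- ★ J′ p855450 (LH4-p08): `forall_normalisedAt_mapGL_diagonal_latt_iff`; brings ★ J p855425 `existsUnique_zpow_diagonal_normalised`
import Summits.HodgeConjecture.HodgeConjecture.Theorems.F0P3cDyRamDiagonalFixedFinite          -- ★ H p855247 (LH4-p10): `finite_setOf_isVertexLattice_mapGL_diagonal_eq` (the `T`-fixed vertices are finitely many)
import Summits.HodgeConjecture.HodgeConjecture.Theorems.F0P3cDyRamDiagonalStableLatticesFinite  -- ★ (LH4-p12): `finite_setOf_normalised_diagonal_fixed_latt` (`𝓛₀(T)` is finite)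
import HarnessLib

/-!
# Crux `H413`, line LH4 «(D-RAM) FOUR-FRAME» road — unit U3_Laws (iii), (R-17) MS ROAD A step (3), brick (O2a): «PAIRS RE-INDEXED BY NORMALISATION» — the `T`-fixed vertex
# lattices of a diagonal form are in bijection with the pairs (normalised `T`-stable lattice `M₀ ∈ 𝓛₀(T)`, exponent vector `a ∈ ℤ^N`) whose translate `diag(ϖ^{a})·M₀` is a vertex

Cell `hodgecm-mathlib` (D-0151), FLOOR 0, crux item H413 = `stmt-HodgeConjecture-24833`, route of record `HCCMUnconditional`; squad F0∕P3c∕LH4 (req618∕req620); registered stub served: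
`F0P3cDyRamFourFrameU3.stub_U3_stableModelSum` (MS; tree `Cruxes/H413/Lines/F0_P3c_DyRamFourFrame_U3_Laws.lean` :107).  THEOREMS ONLY (no `def`, no instance, no notation, no
`sorry`, default heartbeats); lane `--supports stmt-HodgeConjecture-24833 --as helper` (count-neutral).  MS ROAD A (LH4-p10 (g0) MEMO-stableLaw-finite v1 §2 (3); LH4-p11 (g0)
`MS-ROAD-A-BRICKS.v2` step (3) = (3c-iii) «orbit count» (O) = (O1) + (O2), (O2) = (O2a) re-indexing + (O2b) fibre count along a `𝒯`-orbit + (O2c) assembly).  This file is (O2a),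
statement BY SIGNATURE as dealt on the squad bus 2026-09-03T23:20:09Z (readback 23:23:53Z), in the currency of the ★ DEFS LEAF `F0P3cDyRamDiagonalTorusDefs`.

THE MATHEMATICS.  Fix a diagonal `T = diag(s) ∈ GL_N(K)`, a diagonal form `diag(D)` and a vertex type `t`.  Every `T`-fixed vertex lattice `M` is a full lattice `latt g`
(definition of ★ `IsVertexLattice`), so by ★ J (`existsUnique_zpow_diagonal_normalised`) there is a UNIQUE `a ∈ ℤ^N` with `M₀ := diag(ϖ^{a})·M` normalised (every coordinate
ideal `= 𝒪`); `M₀` is again `latt (diag(ϖ^{a}) g)`, and `T`-stable because diagonal matrices commute (★ `mapGL_conj_mapGL_eq_iff`), so `M₀ ∈ 𝓛₀(T)` (★ `normalisedStableLattices`);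
and `M = diag(ϖ^{−a})·M₀`.  Conversely a pair `(M₀, b)` with `M₀ ∈ 𝓛₀(T)` and `diag(ϖ^{b})·M₀` a vertex gives the `T`-fixed vertex `diag(ϖ^{b})·M₀`, and the pair is recovered from
it: two normalised lattices in one `ϖ^{ℤ^N}`-orbit are equal (★ J′ `forall_normalisedAt_mapGL_diagonal_latt_iff`: `diag(z)·latt g` normalised iff all `|z_i| = 1`, and `|ϖ^{k}| = 1`
iff `k = 0`).  Hence `(M₀, b) ↦ diag(ϖ^{b})·M₀` is a BIJECTION from `{(M₀, b) : M₀ ∈ 𝓛₀(T), diag(ϖ^{b})·M₀ a type-t vertex of diag(D)}` onto `{M : M a type-t vertex of diag(D),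
T·M = M}` (§2), an identity of `Set.ncard`s with no finiteness needed (§2 head `ncard_fixed_vertices_eq_ncard_normalised_pairs`, generic `N`).  At `N = 3`, for a regular unit
`T` over a finite residue field both sides are finite (★ H p855247, ★ `𝓛₀` finite), so summing over the eight sign classes `e : Fin 3 → Bool` (forms `d_e = diag(c^{e_i})`) and
regrouping the pairs by their first coordinate `M₀ ∈ 𝓛₀(T)` (§1, fibrewise `Set.ncard` bookkeeping) gives the dealt head (§3)
`Σ_e #{M : type-t for diag(d_e), T·M = M} = Σᶠ_{M₀ ∈ 𝓛₀(T)} #{(e, b) : diag(ϖ^{b})·M₀ type-t for diag(d_e)}` — the left side is the summand of MS :107 token for token; the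
right side is what (O2b) counts along each `𝒯`-orbit (★ (O1) p855595) and (O2c) assembles.  No number theory: pure re-indexing.

WHAT IS PROVED (generic valued field `K` with `Valued K ℤᵐ⁰`; the unit uniformiser is a binder `ϖu : Kˣ` with `(ϖu : K) = ϖ` — instantiate `ϖu := Units.mk0 ϖ hϖ0`).
* §1 `ncard_setOf_mem_and_mem_eq_finsum_mem`, `ncard_setOf_mem_eq_sum` — fibrewise count of a set of pairs (`Set.Finite.ncard_biUnion`).
* §2 `coe_diagGLUnits_zpow`, `diagGLUnits_mul_mul_inv_eq_of_coe_eq_diagonal`, `mapGL_mapGL_diagGLUnits_eq_iff` (`T`-stability rides along diagonal translates, generic `N`),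
  `diagGLUnits_zpow_neg`, `diagGLUnits_zpow_inv_mul`, `zpow_exponent_eq_zero_of_normalised` (two normalised members of one `ϖ^{ℤ^N}`-orbit coincide),
  `injOn_mapGL_diagGLUnits_zpow`, `image_mapGL_diagGLUnits_zpow_normalisedPairs_eq`, HEAD `ncard_fixed_vertices_eq_ncard_normalised_pairs`,
  `finite_normalisedPairs_of_finite_fixed_vertices`.
* §3 HEAD (O2a) `sum_ncard_fixed_vertices_eq_finsum_ncard_pairs` (`N = 3`, eight classes, regrouped over `𝓛₀(T)`), and its `Finset` spelling `sum_ncard_fixed_vertices_eq_sum_toFinset_ncard_pairs`.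
HONEST LABEL.  Count-neutral (`--supports`); nothing printed is asserted; (MS) stays a PROVER TARGET (empirical census law); `HC_CM` is proved only modulo the 7 printed citations
(2 remaining named inputs: hLiu418 = `stmt-HodgeConjecture-24832`, h413 = `stmt-HodgeConjecture-24833`) until rung 0 closes.

## References
* [Kottwitz1986BaseChangeUnits] R. E. Kottwitz, *Base change for unit elements of Hecke algebras*, Compositio Math. 60 (1986), §1 pp. 240–241 (orbital integrals of units as lattice
  counts modulo the torus).
* [Serre1980Trees] J.-P. Serre, *Trees*, Springer (1980), Ch. II §1.1 (lattices `g·𝒪^N`, lattice classes, the diagonal action).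
* [BruhatTits1972] F. Bruhat, J. Tits, *Groupes réductifs sur un corps local I*, Publ. Math. IHÉS 41 (1972), §10 (apartment of the diagonal torus: vertices `diag(ϖ^{a})·𝒪^N`).
-/

set_option autoImplicit false

noncomputable section

namespace Summit.HodgeConjecture.HodgeConjecture.Cruxes.H413.F0P3cDyRamDiagonalPairReindex

open Matrix
open Literature.NumberTheory.Automorphic Literature.NumberTheory.Automorphic.HermitianLattice
open Literature.NumberTheory.Automorphic.UnitaryLatticeTree
open Summit.HodgeConjecture.HodgeConjecture.Cruxes.H413.F0P3cDyRamDiagonalTorusDefs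
open Summit.HodgeConjecture.HodgeConjecture.Cruxes.H413.F0P3cDyRamDiagonalNormalisedSection
open Summit.HodgeConjecture.HodgeConjecture.Cruxes.H413.F0P3cDyRamDiagonalNormalisedOrbit
open Summit.HodgeConjecture.HodgeConjecture.Cruxes.H413.F0P3cDyRamDiagonalFixedFinite
open Summit.HodgeConjecture.HodgeConjecture.Cruxes.H413.F0P3cDyRamDiagonalStableLatticesFinite
open scoped Valued WithZero Matrix MatrixGroups

/-! ## §1  Fibrewise count of a set of pairs -/

/-- **Fibrewise count of a set of pairs**: for a finite index set `t` and finite fibres `B a` (`a ∈ t`), `#{(a, b) : a ∈ t, b ∈ B a} = Σᶠ_{a ∈ t} #(B a)` — the set is the disjoint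
union over `a ∈ t` of the slices `{a} × B a` (`Set.Finite.ncard_biUnion`). [cite: Serre1980Trees, II §1.1] -/
theorem ncard_setOf_mem_and_mem_eq_finsum_mem {α β : Type*} {t : Set α} (ht : t.Finite) (B : α → Set β) (hB : ∀ a ∈ t, (B a).Finite) :
    {p : α × β | p.1 ∈ t ∧ p.2 ∈ B p.1}.ncard = ∑ᶠ a ∈ t, (B a).ncard := by
  have hU : {p : α × β | p.1 ∈ t ∧ p.2 ∈ B p.1} = ⋃ a ∈ t, Prod.mk a '' B a := by
    ext ⟨a, b⟩
    simp only [Set.mem_setOf_eq, Set.mem_iUnion, Set.mem_image, Prod.mk.injEq]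
    constructor
    · rintro ⟨ha, hb⟩
      exact ⟨a, ha, b, hb, rfl, rfl⟩
    · rintro ⟨a', ha', b', hb', rfl, rfl⟩
      exact ⟨ha', hb'⟩
  rw [hU, Set.Finite.ncard_biUnion ht (fun a ha => (hB a ha).image _) ?_]
  · exact finsum_mem_congr rfl fun a _ => Set.ncard_image_of_injective _ (Prod.mk_right_injective a)
  · intro a _ a' _ hne
    refine Set.disjoint_left.2 fun p hp hp' => ?_
    obtain ⟨b, -, rfl⟩ := hp
    obtain ⟨b', -, h⟩ := hp'
    exact hne ((Prod.mk.inj h).1).symm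

/-- **Fibrewise count over a finite type**: `#{(a, b) : b ∈ B a} = Σ_{a} #(B a)` for finite fibres. [cite: Serre1980Trees, II §1.1] -/
theorem ncard_setOf_mem_eq_sum {α β : Type*} [Fintype α] (B : α → Set β) (hB : ∀ a, (B a).Finite) :
    {p : α × β | p.2 ∈ B p.1}.ncard = ∑ a, (B a).ncard := by
  have h := ncard_setOf_mem_and_mem_eq_finsum_mem Set.finite_univ B (fun a _ => hB a)
  rw [finsum_mem_univ, finsum_eq_sum_of_fintype] at h
  rw [← h]
  congr 1
  ext p
  simp only [Set.mem_setOf_eq, Set.mem_univ, true_and]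

/-! ## §2  The re-indexing bijection `(M₀, b) ↦ diag(ϖ^{b})·M₀` (generic `N`, one form, any type) -/

variable {K : Type*} [Field K] [Valued K ℤᵐ⁰] {N : ℕ}

omit [Valued K ℤᵐ⁰] in
/-- The matrix of `diagGLUnits (ϖu^{a})` is `diag((ϖu : K)^{a_i})`. [cite: BruhatTits1972, §10] -/
theorem coe_diagGLUnits_zpow (ϖu : Kˣ) (a : Fin N → ℤ) :
    ((diagGLUnits fun i => ϖu ^ a i : GL (Fin N) K) : Matrix (Fin N) (Fin N) K) = Matrix.diagonal fun i => (ϖu : K) ^ a i := by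
  rw [coe_diagGLUnits]
  congr 1
  funext i
  exact Units.val_zpow_eq_zpow_val ϖu (a i)

omit [Valued K ℤᵐ⁰] in
/-- Diagonal elements commute: `diag(z) · T · diag(z)⁻¹ = T` for `T = diag(s)`. [cite: Serre1980Trees, II §1.1] -/
theorem diagGLUnits_mul_mul_inv_eq_of_coe_eq_diagonal (z : Fin N → Kˣ) {s : Fin N → K} (T : GL (Fin N) K) (hT : (T : Matrix (Fin N) (Fin N) K) = Matrix.diagonal s) :
    diagGLUnits z * T * (diagGLUnits z)⁻¹ = T := by
  have hcomm : diagGLUnits z * T = T * diagGLUnits z := by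
    apply Units.ext
    rw [Units.val_mul, Units.val_mul, coe_diagGLUnits, hT, Matrix.diagonal_mul_diagonal, Matrix.diagonal_mul_diagonal]
    congr 1
    funext i
    exact mul_comm _ _
  rw [hcomm, mul_inv_cancel_right]

/-- **`T`-stability rides along diagonal translates** (brick K (a), generic `N`): for `T = diag(s)` and any `z ∈ (K^×)^N`, `T·(diag(z)·M) = diag(z)·M ↔ T·M = M`.
[cite: Serre1980Trees, II §1.1] [cite: Kottwitz1986BaseChangeUnits, §1 pp. 240–241] -/
theorem mapGL_mapGL_diagGLUnits_eq_iff (z : Fin N → Kˣ) {s : Fin N → K} (T : GL (Fin N) K) (hT : (T : Matrix (Fin N) (Fin N) K) = Matrix.diagonal s)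
    (M : Submodule 𝒪[K] (Fin N → K)) : mapGL T (mapGL (diagGLUnits z) M) = mapGL (diagGLUnits z) M ↔ mapGL T M = M := by
  have h := mapGL_conj_mapGL_eq_iff (diagGLUnits z) T M
  rwa [diagGLUnits_mul_mul_inv_eq_of_coe_eq_diagonal z T hT] at h

omit [Valued K ℤᵐ⁰] in
/-- `diag(ϖu^{−a}) = diag(ϖu^{a})⁻¹`. [cite: BruhatTits1972, §10] -/
theorem diagGLUnits_zpow_neg (ϖu : Kˣ) (a : Fin N → ℤ) :
    (diagGLUnits fun i => ϖu ^ (-a i) : GL (Fin N) K) = (diagGLUnits fun i => ϖu ^ a i)⁻¹ := by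
  rw [← map_inv]
  congr 1
  funext i
  rw [Pi.inv_apply, _root_.zpow_neg]

omit [Valued K ℤᵐ⁰] in
/-- `diag(ϖu^{b})⁻¹ · diag(ϖu^{a}) = diag(ϖu^{a − b})`. [cite: BruhatTits1972, §10] -/
theorem diagGLUnits_zpow_inv_mul (ϖu : Kˣ) (a b : Fin N → ℤ) :
    ((diagGLUnits fun i => ϖu ^ b i)⁻¹ * diagGLUnits fun i => ϖu ^ a i : GL (Fin N) K) = diagGLUnits fun i => ϖu ^ (a i - b i) := by
  rw [← map_inv, ← map_mul]
  congr 1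
  funext i
  rw [Pi.mul_apply, Pi.inv_apply, ← _root_.zpow_neg, ← _root_.zpow_add, neg_add_eq_sub]

/-- **Two normalised members of one `ϖ^{ℤ^N}`-orbit coincide**: if `latt g` is normalised and `diag(ϖ^{k})·latt g` is normalised too (`|ϖ| = exp(−1)`), then `k = 0` — ★ J′
`forall_normalisedAt_mapGL_diagonal_latt_iff` gives `|ϖ^{k_i}| = 1`, i.e. `exp(−k_i) = 1`. [cite: Serre1980Trees, II §1.1] [cite: BruhatTits1972, §10] -/
theorem zpow_exponent_eq_zero_of_normalised {ϖ : K} (hϖ : Valued.v ϖ = WithZero.exp (-1 : ℤ)) (ϖu : Kˣ) (hϖu : (ϖu : K) = ϖ) (g : GL (Fin N) K)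
    (hg : IsNormalisedLattice (latt (g : Matrix (Fin N) (Fin N) K))) (k : Fin N → ℤ)
    (hk : IsNormalisedLattice (mapGL (diagGLUnits fun i => ϖu ^ k i) (latt (g : Matrix (Fin N) (Fin N) K)))) : k = 0 := by
  have h1 := (forall_normalisedAt_mapGL_diagonal_latt_iff g (fun i => (ϖu : K) ^ k i) (diagGLUnits fun i => ϖu ^ k i) (coe_diagGLUnits_zpow ϖu k) hg).1 hk
  funext i
  have h2 := h1 i
  rw [hϖu, map_zpow₀, hϖ, ← WithZero.exp_zsmul, smul_eq_mul, mul_neg, mul_one, WithZero.exp_eq_one, neg_eq_zero] at h2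
  exact h2

/-- **INJECTIVITY of `(M₀, b) ↦ diag(ϖ^{b})·M₀` on pairs with `M₀` a normalised full lattice** (in particular on `𝓛₀(T) × ℤ^N`): from `diag(ϖ^{b})·M₀ = diag(ϖ^{b'})·M₀'` we get
`M₀' = diag(ϖ^{b−b'})·M₀`, two normalised members of one orbit, so `b = b'` (`zpow_exponent_eq_zero_of_normalised`) and then `M₀ = M₀'` (★ `mapGL_injective`).
[cite: Serre1980Trees, II §1.1] [cite: BruhatTits1972, §10] -/
theorem injOn_mapGL_diagGLUnits_zpow {ϖ : K} (hϖ : Valued.v ϖ = WithZero.exp (-1 : ℤ)) (ϖu : Kˣ) (hϖu : (ϖu : K) = ϖ) :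
    Set.InjOn (fun p : Submodule 𝒪[K] (Fin N → K) × (Fin N → ℤ) => mapGL (diagGLUnits fun i => ϖu ^ p.2 i) p.1)
      {p | (∃ g : GL (Fin N) K, p.1 = latt (g : Matrix (Fin N) (Fin N) K)) ∧ IsNormalisedLattice p.1} := by
  rintro ⟨M₀, b⟩ ⟨⟨g, hg⟩, hn⟩ ⟨M₀', b'⟩ ⟨-, hn'⟩ h
  dsimp only at hg hn hn' h
  -- `M₀' = diag(ϖ^{b − b'})·M₀`
  have h' : M₀' = mapGL (diagGLUnits fun i => ϖu ^ (b i - b' i)) M₀ := by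
    have := congrArg (mapGL (diagGLUnits fun i => ϖu ^ b' i)⁻¹) h
    rw [mapGL_inv_mapGL, ← mapGL_mul, diagGLUnits_zpow_inv_mul] at this
    exact this.symm
  subst hg
  have hk : (fun i => b i - b' i) = 0 := zpow_exponent_eq_zero_of_normalised hϖ ϖu hϖu g hn _ (h' ▸ hn')
  have hbb : b = b' := by
    funext i
    have := congrFun hk i
    exact sub_eq_zero.1 this
  subst hbb
  exact Prod.ext (mapGL_injective _ h) rfl

/-- **THE IMAGE of `(M₀, b) ↦ diag(ϖ^{b})·M₀` on `{(M₀, b) : M₀ ∈ 𝓛₀(T), diag(ϖ^{b})·M₀ a type-t vertex of diag(D)}` IS `{M : type-t vertex of diag(D), T·M = M}`**: «⊆» —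
`T`-stability rides along (diagonals commute); «⊇» — a `T`-fixed vertex `M = latt g` has ★ J's unique normalising exponent `a`, `M₀ := diag(ϖ^{a})·M ∈ 𝓛₀(T)` and
`M = diag(ϖ^{−a})·M₀`. [cite: Kottwitz1986BaseChangeUnits, §1 pp. 240–241] [cite: Serre1980Trees, II §1.1] [cite: BruhatTits1972, §10] -/
theorem image_mapGL_diagGLUnits_zpow_normalisedPairs_eq (σ : K →+* K) {ϖ : K} (hϖ : Valued.v ϖ = WithZero.exp (-1 : ℤ)) (ϖu : Kˣ) (hϖu : (ϖu : K) = ϖ)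
    (D : Fin N → K) (t : ℕ) {s : Fin N → K} (T : GL (Fin N) K) (hT : (T : Matrix (Fin N) (Fin N) K) = Matrix.diagonal s) :
    (fun p : Submodule 𝒪[K] (Fin N → K) × (Fin N → ℤ) => mapGL (diagGLUnits fun i => ϖu ^ p.2 i) p.1) ''
        {p | p.1 ∈ normalisedStableLattices T ∧ IsVertexLattice σ ϖ (Matrix.diagonal D) t (mapGL (diagGLUnits fun i => ϖu ^ p.2 i) p.1)} =
      {M : Submodule 𝒪[K] (Fin N → K) | IsVertexLattice σ ϖ (Matrix.diagonal D) t M ∧ mapGL T M = M} := by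
  ext M
  simp only [Set.mem_image, Set.mem_setOf_eq, mem_normalisedStableLattices_iff]
  constructor
  · rintro ⟨⟨M₀, b⟩, ⟨⟨-, hTM₀, -⟩, hV⟩, rfl⟩
    exact ⟨hV, (mapGL_mapGL_diagGLUnits_eq_iff _ T hT M₀).2 hTM₀⟩
  · rintro ⟨hV, hTM⟩
    obtain ⟨g, hMg, -⟩ := id hV
    obtain ⟨a, ha, -⟩ := existsUnique_zpow_diagonal_normalised hϖ g
    have hZ : ((diagGLUnits fun i => ϖu ^ a i : GL (Fin N) K) : Matrix (Fin N) (Fin N) K) = Matrix.diagonal fun i => ϖ ^ a i := by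
      rw [coe_diagGLUnits_zpow, hϖu]
    refine ⟨⟨mapGL (diagGLUnits fun i => ϖu ^ a i) M, fun i => -a i⟩, ⟨⟨⟨diagGLUnits (fun i => ϖu ^ a i) * g, ?_⟩, ?_, ?_⟩, ?_⟩, ?_⟩
    · rw [hMg, mapGL_latt]
    · exact (mapGL_mapGL_diagGLUnits_eq_iff _ T hT M).2 hTM
    · unfold IsNormalisedLattice
      intro i
      rw [hMg]
      exact ha _ hZ i
    · dsimp only
      rw [diagGLUnits_zpow_neg, mapGL_inv_mapGL]
      exact hV
    · dsimp only
      rw [diagGLUnits_zpow_neg, mapGL_inv_mapGL]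

/-- **§2 HEAD · «PAIRS RE-INDEXED BY NORMALISATION», ONE FORM (generic `N`, any diagonal form `diag(D)`, any type `t`, no finiteness, no `σ`-hypothesis)**: the `T`-fixed type-`t`
vertex lattices of `diag(D)` are equinumerous (`Set.ncard`, both `0` if infinite) with the pairs `(M₀, b)`, `M₀ ∈ 𝓛₀(T)` a normalised `T`-stable lattice and `b ∈ ℤ^N`, whose
translate `diag(ϖ^{b})·M₀` is a type-`t` vertex of `diag(D)` — the map `(M₀, b) ↦ diag(ϖ^{b})·M₀` is injective (`injOn_mapGL_diagGLUnits_zpow`) with exactly that image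
(`image_mapGL_diagGLUnits_zpow_normalisedPairs_eq`).  `ϖu : Kˣ` is the uniformiser as a unit (`(ϖu : K) = ϖ`; instantiate `Units.mk0 ϖ hϖ0`).
[cite: Kottwitz1986BaseChangeUnits, §1 pp. 240–241] [cite: Serre1980Trees, II §1.1] [cite: BruhatTits1972, §10] -/
theorem ncard_fixed_vertices_eq_ncard_normalised_pairs (σ : K →+* K) {ϖ : K} (hϖ : Valued.v ϖ = WithZero.exp (-1 : ℤ)) (ϖu : Kˣ) (hϖu : (ϖu : K) = ϖ)
    (D : Fin N → K) (t : ℕ) {s : Fin N → K} (T : GL (Fin N) K) (hT : (T : Matrix (Fin N) (Fin N) K) = Matrix.diagonal s) :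
    {M : Submodule 𝒪[K] (Fin N → K) | IsVertexLattice σ ϖ (Matrix.diagonal D) t M ∧ mapGL T M = M}.ncard =
      {p : Submodule 𝒪[K] (Fin N → K) × (Fin N → ℤ) | p.1 ∈ normalisedStableLattices T ∧
        IsVertexLattice σ ϖ (Matrix.diagonal D) t (mapGL (diagGLUnits fun i => ϖu ^ p.2 i) p.1)}.ncard := by
  rw [← image_mapGL_diagGLUnits_zpow_normalisedPairs_eq σ hϖ ϖu hϖu D t T hT]
  refine Set.InjOn.ncard_image ((injOn_mapGL_diagGLUnits_zpow hϖ ϖu hϖu).mono fun p hp => ?_)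
  obtain ⟨⟨hl, -, hn⟩, -⟩ := hp
  exact ⟨hl, hn⟩

/-- **Finiteness transfers along the bijection**: the pair set is finite as soon as the `T`-fixed vertex set is (at `N = 3` for a regular unit `T` over a finite residue field:
★ `finite_setOf_isVertexLattice_mapGL_diagonal_eq`). [cite: Kottwitz1986BaseChangeUnits, §1 pp. 240–241] [cite: Serre1980Trees, II §1.1] -/
theorem finite_normalisedPairs_of_finite_fixed_vertices (σ : K →+* K) {ϖ : K} (hϖ : Valued.v ϖ = WithZero.exp (-1 : ℤ)) (ϖu : Kˣ) (hϖu : (ϖu : K) = ϖ)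
    (D : Fin N → K) (t : ℕ) {s : Fin N → K} (T : GL (Fin N) K) (hT : (T : Matrix (Fin N) (Fin N) K) = Matrix.diagonal s)
    (hfin : {M : Submodule 𝒪[K] (Fin N → K) | IsVertexLattice σ ϖ (Matrix.diagonal D) t M ∧ mapGL T M = M}.Finite) :
    {p : Submodule 𝒪[K] (Fin N → K) × (Fin N → ℤ) | p.1 ∈ normalisedStableLattices T ∧
        IsVertexLattice σ ϖ (Matrix.diagonal D) t (mapGL (diagGLUnits fun i => ϖu ^ p.2 i) p.1)}.Finite := by
  rw [← image_mapGL_diagGLUnits_zpow_normalisedPairs_eq σ hϖ ϖu hϖu D t T hT] at hfin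
  refine Set.Finite.of_finite_image hfin ((injOn_mapGL_diagGLUnits_zpow hϖ ϖu hϖu).mono fun p hp => ?_)
  obtain ⟨⟨hl, -, hn⟩, -⟩ := hp
  exact ⟨hl, hn⟩

/-! ## §3  HEAD (O2a): the eight-class sum re-indexed over `𝓛₀(T)` (`N = 3`) -/

/-- **(O2a) «PAIRS RE-INDEXED BY NORMALISATION» — THE DEALT HEAD** (MS ROAD A step (3), LH4-p11 (g0) 2026-09-03T23:20:09Z).  Over a `ℤᵐ⁰`-valued field with finite residue field,
valuation-preserving `σ`, uniformiser `ϖ` (`ϖu` the same element as a unit), a unit `c`, and a REGULAR UNIT diagonal `T = diag(s)` (`|s_i| = 1`, `s` injective): for every type `t`,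
`Σ_{e : Fin 3 → Bool} #{M : M a type-t vertex lattice of diag(d_e), T·M = M} = Σᶠ_{M₀ ∈ 𝓛₀(T)} #{(e, b) : diag(ϖ^{b})·M₀ a type-t vertex lattice of diag(d_e)}`,
`d_e i = c` if `e i` else `1` — the summand on the left is that of MS :107 token for token (`tv := t`); on the right `𝓛₀(T) = normalisedStableLattices T` (★ DEFS LEAF) is finite
(★ `finite_setOf_normalised_diagonal_fixed_latt`) and every fibre is finite (★ H p855247 through §2), so this is a genuine regrouping of a finite set of triples `(e, M₀, b)`:
§2's bijection class by class, then §1's fibrewise count twice (over `M₀ ∈ 𝓛₀(T)`, and over the eight `e`) with `Finset.sum_comm` in between.  No dualisability filter on the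
right: empty fibres contribute `0`.  (O2b) counts the right-hand fibres along each `𝒯`-orbit (★ (O1) p855595), (O2c) assembles the orbit count (O).
[cite: Kottwitz1986BaseChangeUnits, §1 pp. 240–241] [cite: Rogawski1990, §4.9 Prop. 4.9.1 (a) p. 55] [cite: Serre1980Trees, II §1.1] -/
theorem sum_ncard_fixed_vertices_eq_finsum_ncard_pairs {K : Type*} [Field K] [Valued K ℤᵐ⁰] [Finite 𝓀[K]] {σ : K →+* K}
    (hvσ : ∀ a, Valued.v (σ a) = Valued.v a) {ϖ : K} (hϖ : Valued.v ϖ = WithZero.exp (-1 : ℤ)) (ϖu : Kˣ) (hϖu : (ϖu : K) = ϖ)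
    {c : K} (hc : Valued.v c = 1) {s : Fin 3 → K} (hs : ∀ i, Valued.v (s i) = 1) (hinj : Function.Injective s)
    (T : GL (Fin 3) K) (hT : (T : Matrix (Fin 3) (Fin 3) K) = Matrix.diagonal s) (t : ℕ) :
    ∑ e : Fin 3 → Bool, {M : Submodule 𝒪[K] (Fin 3 → K) |
        IsVertexLattice σ ϖ (Matrix.diagonal fun i => if e i then c else (1 : K)) t M ∧ mapGL T M = M}.ncard =
      ∑ᶠ M₀ ∈ normalisedStableLattices T, {p : (Fin 3 → Bool) × (Fin 3 → ℤ) |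
        IsVertexLattice σ ϖ (Matrix.diagonal fun i => if p.1 i then c else (1 : K)) t (mapGL (diagGLUnits fun i => ϖu ^ p.2 i) M₀)}.ncard := by
  -- the eight forms have unit entries; the eigenvalues are integral and pairwise distinct
  have hd : ∀ (e : Fin 3 → Bool) (i : Fin 3), Valued.v (if e i then c else (1 : K)) = 1 := by
    intro e i
    split_ifs
    · exact hc
    · exact map_one _
  have hs' : ∀ i, Valued.v (s i) ≤ 1 := fun i => (hs i).le
  -- `𝓛₀(T)` is finite (★ LH4-p12)
  have h𝓛 : (normalisedStableLattices T).Finite :=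
    finite_setOf_normalised_diagonal_fixed_latt hϖ s hs (fun i j hij => hinj.ne hij) T hT
  -- the pair sets are finite, class by class (★ H through §2), hence so is every fibre over `M₀ ∈ 𝓛₀(T)`
  have hSR : ∀ e : Fin 3 → Bool, {p : Submodule 𝒪[K] (Fin 3 → K) × (Fin 3 → ℤ) | p.1 ∈ normalisedStableLattices T ∧
      IsVertexLattice σ ϖ (Matrix.diagonal fun i => if e i then c else (1 : K)) t (mapGL (diagGLUnits fun i => ϖu ^ p.2 i) p.1)}.Finite := fun e =>
    finite_normalisedPairs_of_finite_fixed_vertices σ hϖ ϖu hϖu _ t T hT (finite_setOf_isVertexLattice_mapGL_diagonal_eq hvσ hϖ (hd e) s hs' hinj T hT t)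
  have hA : ∀ (e : Fin 3 → Bool), ∀ M₀ ∈ normalisedStableLattices T, {b : Fin 3 → ℤ |
      IsVertexLattice σ ϖ (Matrix.diagonal fun i => if e i then c else (1 : K)) t (mapGL (diagGLUnits fun i => ϖu ^ b i) M₀)}.Finite := fun e M₀ hM₀ =>
    ((hSR e).preimage (Prod.mk_right_injective M₀).injOn).subset fun b hb => ⟨hM₀, hb⟩
  -- §2 class by class, then §1 over `M₀ ∈ 𝓛₀(T)`
  have h1 : ∀ e : Fin 3 → Bool, {M : Submodule 𝒪[K] (Fin 3 → K) |
        IsVertexLattice σ ϖ (Matrix.diagonal fun i => if e i then c else (1 : K)) t M ∧ mapGL T M = M}.ncard =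
      ∑ᶠ M₀ ∈ normalisedStableLattices T, {b : Fin 3 → ℤ |
        IsVertexLattice σ ϖ (Matrix.diagonal fun i => if e i then c else (1 : K)) t (mapGL (diagGLUnits fun i => ϖu ^ b i) M₀)}.ncard := fun e => by
    rw [ncard_fixed_vertices_eq_ncard_normalised_pairs σ hϖ ϖu hϖu _ t T hT]
    exact ncard_setOf_mem_and_mem_eq_finsum_mem h𝓛 (fun M₀ => {b : Fin 3 → ℤ |
      IsVertexLattice σ ϖ (Matrix.diagonal fun i => if e i then c else (1 : K)) t (mapGL (diagGLUnits fun i => ϖu ^ b i) M₀)}) (hA e)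
  -- §1 over the eight classes, fibre by fibre
  have h2 : ∀ M₀ ∈ normalisedStableLattices T, ∑ e : Fin 3 → Bool, {b : Fin 3 → ℤ |
        IsVertexLattice σ ϖ (Matrix.diagonal fun i => if e i then c else (1 : K)) t (mapGL (diagGLUnits fun i => ϖu ^ b i) M₀)}.ncard =
      {p : (Fin 3 → Bool) × (Fin 3 → ℤ) |
        IsVertexLattice σ ϖ (Matrix.diagonal fun i => if p.1 i then c else (1 : K)) t (mapGL (diagGLUnits fun i => ϖu ^ p.2 i) M₀)}.ncard := fun M₀ hM₀ => by
    have h := ncard_setOf_mem_eq_sum (fun e : Fin 3 → Bool => {b : Fin 3 → ℤ |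
      IsVertexLattice σ ϖ (Matrix.diagonal fun i => if e i then c else (1 : K)) t (mapGL (diagGLUnits fun i => ϖu ^ b i) M₀)}) fun e => hA e M₀ hM₀
    rw [← h]
    congr 1
  -- regroup: swap the finite sum over `e` with the finite sum over `𝓛₀(T)`
  calc ∑ e : Fin 3 → Bool, {M : Submodule 𝒪[K] (Fin 3 → K) |
          IsVertexLattice σ ϖ (Matrix.diagonal fun i => if e i then c else (1 : K)) t M ∧ mapGL T M = M}.ncard
      = ∑ e : Fin 3 → Bool, ∑ M₀ ∈ h𝓛.toFinset, {b : Fin 3 → ℤ |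
          IsVertexLattice σ ϖ (Matrix.diagonal fun i => if e i then c else (1 : K)) t (mapGL (diagGLUnits fun i => ϖu ^ b i) M₀)}.ncard :=
        Finset.sum_congr rfl fun e _ => by rw [h1 e, finsum_mem_eq_finite_toFinset_sum _ h𝓛]
    _ = ∑ M₀ ∈ h𝓛.toFinset, ∑ e : Fin 3 → Bool, {b : Fin 3 → ℤ |
          IsVertexLattice σ ϖ (Matrix.diagonal fun i => if e i then c else (1 : K)) t (mapGL (diagGLUnits fun i => ϖu ^ b i) M₀)}.ncard := Finset.sum_comm
    _ = ∑ M₀ ∈ h𝓛.toFinset, {p : (Fin 3 → Bool) × (Fin 3 → ℤ) |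
          IsVertexLattice σ ϖ (Matrix.diagonal fun i => if p.1 i then c else (1 : K)) t (mapGL (diagGLUnits fun i => ϖu ^ p.2 i) M₀)}.ncard :=
        Finset.sum_congr rfl fun M₀ hM₀ => h2 M₀ (h𝓛.mem_toFinset.1 hM₀)
    _ = ∑ᶠ M₀ ∈ normalisedStableLattices T, {p : (Fin 3 → Bool) × (Fin 3 → ℤ) |
          IsVertexLattice σ ϖ (Matrix.diagonal fun i => if p.1 i then c else (1 : K)) t (mapGL (diagGLUnits fun i => ϖu ^ p.2 i) M₀)}.ncard :=
        (finsum_mem_eq_finite_toFinset_sum _ h𝓛).symm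

/-- **(O2a), `Finset` spelling**: the same identity with the right-hand side written as a `Finset.sum` over `h𝓛.toFinset` for any finiteness witness `h𝓛` of `𝓛₀(T)`
(e.g. ★ `finite_setOf_normalised_diagonal_fixed_latt`; `finsum_mem_eq_finite_toFinset_sum`). [cite: Kottwitz1986BaseChangeUnits, §1 pp. 240–241] [cite: Serre1980Trees, II §1.1] -/
theorem sum_ncard_fixed_vertices_eq_sum_toFinset_ncard_pairs {K : Type*} [Field K] [Valued K ℤᵐ⁰] [Finite 𝓀[K]] {σ : K →+* K}
    (hvσ : ∀ a, Valued.v (σ a) = Valued.v a) {ϖ : K} (hϖ : Valued.v ϖ = WithZero.exp (-1 : ℤ)) (ϖu : Kˣ) (hϖu : (ϖu : K) = ϖ)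
    {c : K} (hc : Valued.v c = 1) {s : Fin 3 → K} (hs : ∀ i, Valued.v (s i) = 1) (hinj : Function.Injective s)
    (T : GL (Fin 3) K) (hT : (T : Matrix (Fin 3) (Fin 3) K) = Matrix.diagonal s) (t : ℕ) (h𝓛 : (normalisedStableLattices T).Finite) :
    ∑ e : Fin 3 → Bool, {M : Submodule 𝒪[K] (Fin 3 → K) |
        IsVertexLattice σ ϖ (Matrix.diagonal fun i => if e i then c else (1 : K)) t M ∧ mapGL T M = M}.ncard =
      ∑ M₀ ∈ h𝓛.toFinset, {p : (Fin 3 → Bool) × (Fin 3 → ℤ) |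
        IsVertexLattice σ ϖ (Matrix.diagonal fun i => if p.1 i then c else (1 : K)) t (mapGL (diagGLUnits fun i => ϖu ^ p.2 i) M₀)}.ncard := by
  rw [sum_ncard_fixed_vertices_eq_finsum_ncard_pairs hvσ hϖ ϖu hϖu hc hs hinj T hT t, finsum_mem_eq_finite_toFinset_sum _ h𝓛]

end Summit.HodgeConjecture.HodgeConjecture.Cruxes.H413.F0P3cDyRamDiagonalPairReindex

end
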